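/-
Copyright: public-domain mathematics; typed transcription for the H21 Literature library (cell lit-balaban,
reader/typer seat r02 gen 6 = literature-prover-lit-balaban-r02-g6-0; fold owner of block B2).

statement-level skeleton of published theorems with citation tags; proofs where landed; nothing here is a claim about the Yang–Mills mass gap

# Bałaban, *(Higgs)₂,₃ quantum fields in a finite volume. II. An upper bound*, Commun. Math. Phys. **86** (1982) 555–594
# — (2.92) p. 576: the Gaussian factor Z^{(j)} of (2.52) «written as a determinant, omitting a numerical factor»

[cite: Balaban1982Higgs2]  T. Bałaban, Commun. Math. Phys. 86 (1982) 555–594.  p. 576 [PDF 22], verbatim: «Let us stress here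
once more that in the density ρ′^{(k)} only the factors Z^{(j)} depend on this field, so we will consider the expansions of these
factors. They are given by the formulas (2.52) rescaled from the Lʲε-lattice to the Lʲη-lattice, thus the field Ã^{(k)} is defined on
the η-lattice, η = L^{−k}. To understand better the properties of the expression in (2.52), let us rescale further from the Lʲη-lattice
to the 1-lattice and let us write it as a determinant. Omitting a numerical factor we have
  [det(C^{(j)}_{Λ₅^{(j)}}(Bʲ(Λ₂^{(j)}), Ã^{L^{−j}}))^{−1}]^{−1/2},   (2.92)
where Λ_i^{(j)} are subsets of the 1-lattice T₁^{(j)} and the configuration Ã^{(k),L^{−j}} is defined on T_{L^{−j}}.»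
(2.52) p. 569: `Z^{(j),Lʲε}_{Λ₅^{(j)}}(…) = (a(L^{j+1}ε)^{d−2}/2π)^{(N/2)|Λ₅^{(j)}|} ∫dφ↾_{Λ₅^{(j)}} exp(−½⟨φ, (C^{(j)}_{Λ₅^{(j)}}(…))^{−1}φ⟩)`
= r14's `B2Sect2BDensities.Z252 d N a ℓ′ Cinv` (= part I's (3.32) `B1GaussNorm331.ZkA`, closed form `Z252_eq`).

WHAT THIS MODULE ADDS (SKELETON row **B2.Eq2.87-2.98**, the last located member (2.92)): in the typed reading of (2.52) — `T` ↤
the sites of Λ₅^{(j)}, `Cinv` ↤ the (positive definite) matrix of the form ⟨φ, C⁻¹φ⟩ on the `N·|Λ₅^{(j)}|` variables, so that the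
covariance is `C = Cinv⁻¹` — the factor Z^{(j)} IS the printed determinant expression times an EXPLICIT numerical factor:
  `eq292 : Z252 d N a ℓ′ Cinv = (a·ℓ′^{d−2})^{(N/2)|T|} · ((det (Cinv⁻¹))⁻¹) ^ (−1/2)`,
i.e. `Z^{(j)} = (numerical factor) · [det(C)⁻¹]^{−1/2}` with `det(C)⁻¹ = det Cinv` (`det_cov_inv`); the numerical factor
`(a(L^{j+1}ε)^{d−2})^{(N/2)|Λ₅^{(j)}|}` is the one r14's `Z252` carries (the 2π's of (2.52) cancel against the Gaussian integral).

HONEST SCOPE.  Finite-dimensional Gaussian bookkeeping over r14's (2.52)/(I.3.32) closed form; the printed rescalings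
`Lʲε-lattice → Lʲη-lattice → 1-lattice` change only the numerical factor and the normalisation of the matrix and are not typed
separately (the identity holds for every positive definite `Cinv`, whatever lattice it came from).  Theorems only.
-/
import Mathlib
import Literature.MathematicalPhysics.QuantumFieldTheory.Balaban1983to89.B2Sect2BDensities

namespace Literature.MathematicalPhysics.QuantumFieldTheory.Balaban1983to89.B2Eq292Determinant

open Literature.MathematicalPhysics.QuantumFieldTheory.Balaban1983to89

/-! ## (2.92): Z^{(j)} as a determinant

statement-level skeleton of published theorems with citation tags; proofs where landed; nothing here is a claim about the Yang–Mills mass gap -/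

variable {T : Type*} [Fintype T] [DecidableEq T] {N : ℕ}

/-- `det(C)⁻¹ = det Cinv` for the covariance `C = Cinv⁻¹` of a positive definite form (the bracket `det(C…)⁻¹` of (2.92)).
[cite: Balaban1982Higgs2, (2.92) p.576] -/
theorem det_cov_inv {Cinv : Matrix (T × Fin N) (T × Fin N) ℝ} (hC : Cinv.PosDef) : ((Cinv⁻¹).det)⁻¹ = Cinv.det := by
  have hdet : Cinv.det ≠ 0 := hC.det_pos.ne'
  rw [Matrix.det_nonsing_inv, Ring.inverse_eq_inv, inv_inv]

/-- **(2.92)** p. 576 [PDF 22], verbatim: *"Omitting a numerical factor we have [det(C^{(j)}_{Λ₅^{(j)}}(Bʲ(Λ₂^{(j)}), Ã^{L^{−j}}))⁻¹]^{−1/2}, (2.92)"*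
— in the typed reading of (2.52) (`B2Sect2BDensities.Z252`, covariance `C = Cinv⁻¹`, `Cinv` positive definite, `a ≥ 0`,
`ℓ′ = L^{j+1}ε > 0`): `Z^{(j)} = (a·ℓ′^{d−2})^{(N/2)|Λ₅^{(j)}|} · [det(C)⁻¹]^{−1/2}`, the numerical factor EXPLICIT.
[cite: Balaban1982Higgs2, (2.92) p.576] -/
theorem eq292 (d : ℕ) {a ℓ' : ℝ} (ha : 0 ≤ a) (hℓ : 0 < ℓ') {Cinv : Matrix (T × Fin N) (T × Fin N) ℝ}
    (hC : Cinv.PosDef) :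
    B2Sect2BDensities.Z252 d N a ℓ' Cinv
      = B1RT.prec a ℓ' d ^ ((N : ℝ) / 2 * (Fintype.card T : ℝ)) * (((Cinv⁻¹).det)⁻¹) ^ (-(1 / 2 : ℝ)) := by
  rw [B2Sect2BDensities.Z252_eq d N ha hℓ hC, det_cov_inv hC, Real.rpow_neg hC.det_pos.le, ← Real.sqrt_eq_rpow, div_eq_mul_inv]

/-- The same with the determinant of the COVARIANCE itself: `Z^{(j)} = (a·ℓ′^{d−2})^{(N/2)|Λ₅^{(j)}|} · (det C)^{1/2}`,
`C = Cinv⁻¹` (since `[det(C)⁻¹]^{−1/2} = (det C)^{1/2}` for `det C > 0`). [cite: Balaban1982Higgs2, (2.92) p.576] -/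
theorem eq292_cov (d : ℕ) {a ℓ' : ℝ} (ha : 0 ≤ a) (hℓ : 0 < ℓ') {Cinv : Matrix (T × Fin N) (T × Fin N) ℝ}
    (hC : Cinv.PosDef) :
    B2Sect2BDensities.Z252 d N a ℓ' Cinv
      = B1RT.prec a ℓ' d ^ ((N : ℝ) / 2 * (Fintype.card T : ℝ)) * ((Cinv⁻¹).det) ^ (1 / 2 : ℝ) := by
  rw [eq292 d ha hℓ hC]
  congr 1
  have hpos : 0 < (Cinv⁻¹).det := by
    rw [Matrix.det_nonsing_inv, Ring.inverse_eq_inv]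
    exact inv_pos.2 hC.det_pos
  rw [Real.rpow_neg (inv_nonneg.2 hpos.le), Real.inv_rpow hpos.le, inv_inv]

/-- (2.92) is a POSITIVE number (so its logarithm / power expansions of §2.C make sense): `a > 0`, `ℓ′ > 0`, `Cinv` positive
definite. [cite: Balaban1982Higgs2, (2.92) p.576] -/
theorem eq292_pos (d : ℕ) {a ℓ' : ℝ} (ha : 0 < a) (hℓ : 0 < ℓ') {Cinv : Matrix (T × Fin N) (T × Fin N) ℝ}
    (hC : Cinv.PosDef) :
    0 < B1RT.prec a ℓ' d ^ ((N : ℝ) / 2 * (Fintype.card T : ℝ)) * (((Cinv⁻¹).det)⁻¹) ^ (-(1 / 2 : ℝ)) := by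
  rw [← eq292 d ha.le hℓ hC]
  exact B2Sect2BDensities.Z252_pos d N ha hℓ hC

end Literature.MathematicalPhysics.QuantumFieldTheory.Balaban1983to89.B2Eq292Determinant
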